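import Literature.MathematicalPhysics.QuantumFieldTheory.Balaban1983to89.B15Prop1MinimiserClassAtDatumScale

/-!
# `Balaban1983to89.B15Prop1MinimiserClassAtDatumScaleAtLength` — [Balaban1985Variational] = «[15]», Thm 1 (8) p. 279, (1)–(7) pp. 277–278; [Balaban1988Convergent] = «[III]», (2.12)–(2.13)
# pp. 256–257; [Balaban1989LargeFieldI] = «[IV]», (1.74) p. 192, p. 193, Prop. 1 p. 194: THE (8)-FLOOR JUNCTION KIT `B15Prop1MinimiserClassAtDatumScale` (✓p746805) WITH THE [15] LETTER READ AT
# THE ONE LENGTH `k` (AT-LENGTH EDITION; no quantification over lengths)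

Honest framing: statement-level skeleton of published theorems with citation tags; proofs where landed; nothing here is a claim about the Yang–Mills mass gap.  Cell `pub-ymgap`
(HUMAN RULINGS D-0062 ∕ D-0149), seat `pub-ymgap-dag-n12-c` g32 (R134 seat (a), N12 = [B15], s1, lane owner); count-neutral helper of K1⁹ `stmt-QuantumFields-27364`
(`--kind proof --supports`); N12 NOT discharged; finite 𝕋⁴ at fixed ε; nothing continuum ∕ ℝ⁴ ∕ OS ∕ mass-gap ∕ Clay.  THEOREMS ONLY (0 `def`, 0 `instance`, 0 `sorry`).

WHY.  The kit ✓p746805 (lane g31; the conversion letters `hKa` ∕ `hKb` of dag-n12-d's T4′ «DatumScale» and the two-radii (J0′) head ✓p746978 are its §3 ∕ §4) displays [15] Theorem 1 (8)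
as the CLOSED TORUS-CLASS LETTER OVER ALL LENGTHS `k' ≤ m + K` with `LᵏʹM₁ ∣ sitesPerDir 0`, yet its core reads the letter ONCE, at the kit's own length `k`.  The all-lengths letter is
served only by the FLOOR-FREE token `Node00.VariationalThm1RegSepCoP7M` (`thm1TorusClass_of_variationalThm1RegSepCoP7M`); the K0 road's REGISTERED grid-guarded token serves the letter AT
ONE LENGTH passing its guard — dag-n12-d `BalabanUVNodesN12Thm1LettersAtLengthOfK0GridG.thm1LetterT_atLength_of_variationalThm1RegSepCoP7MG(_grid)` ∕
`exists_thm1LetterT_atLength_of_prop8StepCoPGridGAt`, whose CONCLUSION at `(ν, Kt, k)` is the binder `h15T` below VERBATIM.  THIS FILE re-issues the kit's five h15-reading theorems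
with that single-length letter (`h15T : ∀ s : Seq (LʲM₁-cube unions) k, <(8)-body at k>`); proofs VERBATIM but for the one call (`h15T k hk hdiv s' …` ↦ `h15T s' …`); §0 ∕ §2 of
the kit (h15-free) are used BY NAME.  So a junction keyed on the K0 road's registered token (or on any at-length producer) discharges `hKa` ∕ `hKb` and the two-radii head's kit step by
name, with no all-lengths letter anywhere.

CONTENTS.  §1 ★★ `mem_withEps_and_isMinimizer_withEps_of_plaqSmallOn_atLength` (core); §3 ★★★ `isMinimizer_withEps_base_of_thm1AtLength` (= `hKa` at length) · ★★★
`hMin_twoRadii_withEps_of_hMin_atLength`; §4 ★★★ `isMinimizer_withEps_of_norm_lt_atLength` (= `hKb` at length) · `eventually_isMinimizer_withEps_of_eventually_atLength`.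

HONEST SCOPE.  Bookkeeping by name over landed modules; [15] Theorem 1 (8) stays DISPLAYED as the closed letter `h15T` (at one length; nothing of Bałaban's asserted); per-instance
constants (census U4); count-neutral; N12 NOT discharged; K0⁷ ∕ K1⁹ NOT closed; counts unmoved; R4 closes only the conditional finite-𝕋⁴ rung `BalabanLadder.UV` — no summit statement is
proved here and NOT the Yang–Mills mass gap (Clay); nothing continuum ∕ ℝ⁴ ∕ OS.
-/

noncomputable section

open Set

namespace Literature.MathematicalPhysics.QuantumFieldTheory.Balaban1983to89.B15Prop1MinimiserClassAtDatumScaleAtLength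

open T4Continuum B15DeterminingSets GaugeField B15Prop1Carrier B8Eq17ClassAkV1 BlockAveraging
open B14.Eq22Determines (IsBlockUnion)
open Literature.MathematicalPhysics.QuantumFieldTheory.BalabanImbrieJaffe1984to88.BIJ85Eq453GaugeField (qsstarGIter0)
open B15Prop1DatumSmall7AtZSequence B15Prop1Thm1GeneralFormAtZSequence B15Prop1Thm1GeneralFormShapes B15Prop1Thm1RowsOfExistsUnique
open B16Sect1Backgrounds (toMS expMul)
open B14DomainGeom (IsUnionOfCubes)
open B15Eq112TorusCover (cover)
open B14.Eq213MaximalDomains (side)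
open B14.Eq213DetSet B15Sect1Instances B16Sect1Wilson
open T4CubeChartGnomonic (SU2)
open T4AxialGaugeSmallField (castSite boxPlaqs)
open B15Extension193 (extend)
open B15ShellGauge193 (shellGauge)
open B15ShellGauge193Local (dist1_plaqHol_extend_shellGauge_le)
open B15Prop1ChartDeviation (dist1_plaqHol_expMul_le_of_forall)
open B15Prop1ChartSU2 (su2Chart dist1_iexp_apply_le)
open B15Prop1ChartCalculusSU2 (E3)
open B15Prop1AnalyticExtClause (cplxVec)
open Metric (ball)
open B15Prop1MinimiserClassAtDatumScale

variable {F : T4Family}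

/-- `0 < η_j`. [folklore] -/
private theorem eta_pos (K j : ℕ) : 0 < (F.P K).eta j := by
  have hL : (0 : ℝ) < (F.P K).L := by exact_mod_cast (F.P K).L_pos
  unfold Params.eta
  positivity

/-! ## §1  The core: a minimiser over the class of record of an `a`-regular datum lies in the class at `B₃a` and minimises over the class at every `e ∈ [B₃a, εreg]` -/

section Core

open Classical

/-- ★★ **AT-LENGTH edition of `B15Prop1MinimiserClassAtDatumScale.mem_withEps_and_isMinimizer_withEps_of_plaqSmallOn` ([15] letter at the one length `k`; proof verbatim, one call). THE MINIMISER OF AN `a`-REGULAR (1.74) DATUM LIES IN THE (2.12) CLASS AT THE DATUM's OWN SCALE `B₃a`, AND MINIMISES OVER THE CLASS AT EVERY TOLERANCE `e ∈ [B₃a, εreg]`.**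
For a level-`k` field `V` with `|V(∂p′) − 1| < a` on the `k`-plaquettes inside `Z` (`0 < a ≤ a₁`, `B₃a ≤ e ≤ εreg ≤ a₀`) and ANY minimiser `U₀` of the Wilson action over NODE 00's class
of record `U_k({Ω_j(Z)}, εreg)` with the data `M˙(Q_k^{s*}V)` on `𝐁_k(Z)`: (i) `U₀ ∈ U_k({Ω_j(Z)}, B₃a)` ([15] Thm 1 (8), the closed torus-class letter `h15T` applied at `ε₀ := εreg` to the
datum's (7) at the constant profile `a` along `Z`'s maximal sequence); (ii) `U₀` minimises over `U_k({Ω_j(Z)}, e)` (it lies in it, and that class lies in the one it minimises over).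
[cite: Balaban1985Variational, (1) p.277, (2),(6),(7) p.278, Thm 1 (8) p.279; Balaban1988Convergent, (2.1) p.254, p.255, (2.12)–(2.13) pp.256–257, (2.18) p.257; Balaban1989LargeFieldI, (1.74) p.192, p.193; Balaban1985RegularSpaces, (1.3)–(1.9) p.77] -/
theorem mem_withEps_and_isMinimizer_withEps_of_plaqSmallOn_atLength (ν : Node00.Stage7Numerics) (Kt : ℕ) (hd : 2 ≤ (F.P Kt).d)
    (Z : Set (Site (F.P Kt) 0)) {k : ℕ} (hk0 : 0 < k) (hk : k ≤ (F.P Kt).m + (F.P Kt).K) (hZblk : IsBlockUnion k Z)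
    (hM2 : 2 ≤ ν.M₁) (hdiv : side (F.P Kt).L ν.M₁ k ∣ (F.P Kt).sitesPerDir 0) {B₃ a₀ a₁ : ℝ}
    -- [15] THEOREM 1 (R) = (8), CLOSED, OVER NODE 00's TORUS CLASS, AT THE ONE LENGTH `k` (the conclusion of dag-n12-d's
    -- `BalabanUVNodesN12Thm1LettersAtLengthOfK0GridG.thm1LetterT_atLength_of_variationalThm1RegSepCoP7MG` at `(ν, Kt, k)` VERBATIM; the all-lengths letter at `k` serves it too)
    (h15T : ∀ (s : B14.Eq218Concrete.Seq (fun n : ℕ => Node00.unionsOfCubes (F.P Kt) (side (F.P Kt).L ν.M₁ n)) k),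
      Node00.Sect2.SeqSeparated ν.M₁ s → 0 < ν.M₁ →
      ∀ (ε₀ : ℝ) (δ : ℕ → ℝ), (∀ j, j ≤ k → 0 < δ j ∧ δ j ≤ a₁ ∧ B₃ * δ j ≤ ε₀) → (∀ j, j < k → δ j ≤ 2 * δ (j + 1)) →
      (∀ j, j < k → δ (j + 1) ≤ 2 * δ j) → ε₀ ≤ a₀ →
      ∀ W : MSField (F.P Kt) SU2,
        Node00.Sect2.DataSmall7PTop (Node00.avOfRecord F 2 Kt) s.Ω (Node00.suppDomOfRecord F ν Kt s.Ω) k δ W →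
        ∀ U₀ : GaugeField (F.P Kt) 0 SU2, IsMinimizer (Node00.avOfRecord F 2 Kt)
            {U | (∀ j, j ≤ k → PlaqSmallOn (Node00.Sect2.omegaPlaqsTop s.Ω (Node00.suppDomOfRecord F ν Kt s.Ω) j)
                (ε₀ * (F.P Kt).eta j ^ 2) U) ∧
              Node00.Sect2.CoDivClassOnTop s.Ω (Node00.suppDomOfRecord F ν Kt s.Ω) k ε₀ U}
            (genSet s.Ω k) W U₀ →
          (∀ j, j ≤ k → PlaqSmallOn (Node00.Sect2.omegaPlaqsTop s.Ω (Node00.suppDomOfRecord F ν Kt s.Ω) j)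
              (B₃ * δ j * (F.P Kt).eta j ^ 2) U₀) ∧
            ∀ j, j ≤ k → Node00.Sect2.CoDivSmallOn (Node00.Sect2.omegaBondsTop s.Ω (Node00.suppDomOfRecord F ν Kt s.Ω) j)
              (B₃ * δ j * (F.P Kt).eta j ^ 3) U₀) :
    ∀ (a e : ℝ) (V : GaugeField (F.P Kt) k SU2), 0 < a → a ≤ a₁ → B₃ * a ≤ e → e ≤ ν.εreg → ν.εreg ≤ a₀ →
      PlaqSmallOn (plaqsInside (pts k Z)) a V →
      ∀ U₀ : GaugeField (F.P Kt) 0 SU2,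
        IsMinimizer (Node00.avOfRecord F 2 Kt) (Node00.regMSCoPOfRecord F 2 ν Kt k (maxDomT ν.M₁ Z)) (Bj ν.M₁ Z k)
          (avgFamily (Node00.avOfRecord F 2 Kt) (qsstarGIter0 k V)) U₀ →
        U₀ ∈ Node00.regMSCoPOfRecord F 2 {ν with εreg := B₃ * a} Kt k (maxDomT ν.M₁ Z) ∧
          IsMinimizer (Node00.avOfRecord F 2 Kt) (Node00.regMSCoPOfRecord F 2 {ν with εreg := e} Kt k (maxDomT ν.M₁ Z)) (Bj ν.M₁ Z k)
            (avgFamily (Node00.avOfRecord F 2 Kt) (qsstarGIter0 k V)) U₀ := by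
  intro a e V ha haa₁ hae heν ha₀ hV U₀ hU₀
  have hM : 1 ≤ ν.M₁ := le_trans one_le_two hM2
  have hki : 1 ≤ k := hk0
  -- `Z`'s maximal sequence as a separated (2.18) index, with print's cube letters, re-indexed over NODE 00's torus class
  obtain ⟨s, hsΩ, -, hscube, hsep⟩ := exists_seq_maxDomT hM Z hdiv
  obtain ⟨s', hΩ'⟩ := exists_seq_torusClass_of_cubeLetters hM s hscube
  have hsep' : Node00.Sect2.SeqSeparated ν.M₁ s' := (seqSeparated_iff_of_Ω_eq ν.M₁ hΩ').2 hsep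
  have hw1 : s.Ω 1 = maxDomT ν.M₁ Z 1 := hsΩ 1 le_rfl hki
  -- print's (7) for the datum ALONG THE INDEX `s.Ω`, constant profile `a`
  have h0 : Node00.Sect2.printedPlaqsTop s.Ω (Node00.suppDomOfRecord F ν Kt s.Ω) k ⊆ plaqsInside Z := by
    rw [printedPlaqsTop_congr hki hsΩ, Node00.suppDomOfRecord_congr (F := F) ν Kt hw1]
    exact printedPlaqsTop_maxDomT_subset_plaqsInside hM hdiv hki k
  have hsucc : ∀ m, m + 1 ≤ k → Node00.Sect2.printedPlaqs s.Ω k (m + 1) ⊆ plaqsInside (pts (m + 1) Z) := by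
    intro m hm
    refine (Node00.Sect2.printedPlaqs_subset_plaqsOf _ _ _).trans ?_
    refine (plaqsOf_mono (genSet_subset_pts_of_one_le s.Ω k (Nat.succ_pos m))).trans ?_
    rw [hsΩ (m + 1) (Nat.succ_pos m) hm]
    exact plaqsOf_pts_maxDomT_subset_plaqsInside hM2 hdiv (Nat.succ_pos m) hm
  have h7 : Node00.Sect2.DataSmall7PTop (Node00.avOfRecord F 2 Kt) s.Ω (Node00.suppDomOfRecord F ν Kt s.Ω) k
      (fun _ => a) (avgFamily (Node00.avOfRecord F 2 Kt) (qsstarGIter0 k V)) :=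
    dataSmall7PTop_avgFamily_qsstarGIter0 hd ExpMeanLog.expMeanLogSU T3DescentFibreTower.expMeanLogSU_E_one rfl hk
      s.Ω _ Z hZblk h0 hsucc (fun _ _ => ha) V (fun _ _ => hV)
  -- numerics of the thresholds at `ε₀ := εreg`
  have hnum : ∀ j, j ≤ k → 0 < a ∧ a ≤ a₁ ∧ B₃ * a ≤ ν.εreg := fun j _ => ⟨ha, haa₁, hae.trans heν⟩
  -- (8) at the index `s'`, read back at `s.Ω`, applied to the datum at `ε₀ := εreg`
  have h8 := h15T s' hsep' hM
  rw [hΩ'] at h8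
  have h8W := h8 ν.εreg (fun _ => a) hnum (fun _ _ => by linarith) (fun _ _ => by linarith) ha₀ _ h7
  clear h8
  -- the class literal at `εreg` IS the class of record (at `ν⟨εreg := εreg⟩ = ν`); the (1.74) class and determining set at `maxDomT ν.M₁ Z` ARE those at the index `s`
  rw [setOf_class_eq_regMSCoPOfRecord] at h8W
  have hreg0 : Node00.regMSCoPOfRecord F 2 ν Kt k (maxDomT ν.M₁ Z) = Node00.regMSCoPOfRecord F 2 ν Kt k s.Ω := (regMSCoPOfRecord_congr F 2 _ Kt hki hsΩ).symm
  have hreg : ∀ e' : ℝ, Node00.regMSCoPOfRecord F 2 {ν with εreg := e'} Kt k (maxDomT ν.M₁ Z) =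
      Node00.regMSCoPOfRecord F 2 {ν with εreg := e'} Kt k s.Ω := fun e' => (regMSCoPOfRecord_congr F 2 _ Kt hki hsΩ).symm
  have hB : Bj ν.M₁ Z k = genSet s.Ω k := (genSet_congr hki hsΩ).symm
  rw [hreg0, hB] at hU₀
  have h8U := h8W U₀ hU₀
  -- (i) membership at every tolerance `e' ≥ B₃a` (at the index `s.Ω`)
  have hmem : ∀ e' : ℝ, B₃ * a ≤ e' → U₀ ∈ Node00.regMSCoPOfRecord F 2 {ν with εreg := e'} Kt k s.Ω := by
    intro e' he'
    refine ⟨fun j hj p hp => ((h8U.1 j hj) p hp).trans_le ?_, fun j hj b hb => ((h8U.2 j hj) b hb).trans_le ?_⟩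
    · exact mul_le_mul_of_nonneg_right he' (pow_nonneg (eta_pos Kt j).le 2)
    · exact mul_le_mul_of_nonneg_right he' (pow_nonneg (eta_pos Kt j).le 3)
  refine ⟨?_, ?_⟩
  · rw [hreg (B₃ * a)]
    exact hmem (B₃ * a) le_rfl
  · -- (ii) minimality over the class at `e`: `U₀ ∈` class(e) `⊆` class(εreg) over which it minimises
    rw [hreg e, hB]
    exact isMinimizer_of_mem_of_subset (Node00.avOfRecord F 2 Kt) hU₀ (regMSCoPOfRecord_withEps_subset ν Kt k s.Ω heν) (hmem e hae)

end Core

/-! ## §3  At the base point and on the (J0′) family's real points: minimality over the class AT THE DATUM SCALE; T4's `hMin` body in TWO-RADII form -/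

section AtDatumScale

variable {Kt : ℕ}

/-- ★★★ **AT-LENGTH edition of `…AtDatumScale.isMinimizer_withEps_base_of_thm1TorusClass` (= T4′'s `hKa` with the [15] letter at the one length `k`). THE BASE POINT: the minimiser `U₀` of the (1.74) datum of an `eR`-regular base field MINIMISES OVER THE CLASS AT EVERY TOLERANCE `e ∈ [B₃(c_E+1)eR, εreg]` AND LIES IN THE
CLASS AT `B₃(c_E+1)eR`** — what the direct road's class-reading producers ((σ)_W window gauge, plaquette letters, tower∕site proxies, chart-half `hmin0`) may be fed at
`ν″ := ν⟨εreg := e⟩` instead of `ν`, so that their tolerance floors read the DATA budget `eR` instead of the class constant `εreg` (lane ruling «(8)-FLOOR»).  Binders: the knit's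
geometry rows of the instance (`Z, Λ, k, lo, hi, n, ext`, as in `B15Prop1Thm1RowsOfExistsUnique.thm1Rows_atZ_…` for one `i`), numerics `(c_E+1)eR ≤ a₁`, `B₃(c_E+1)eR ≤ e ≤ εreg ≤ a₀`,
the closed (8)-letter `h15T`. [cite: Balaban1985Variational, (2),(6),(7) p.278, Thm 1 (8) p.279; Balaban1989LargeFieldI, (1.74) p.192, p.193 L14–20, Prop. 1 p.194; Balaban1988Convergent, (2.12)–(2.13) pp.256–257; Balaban1989LargeFieldII, p.357] -/
theorem isMinimizer_withEps_base_of_thm1AtLength (ν : Node00.Stage7Numerics) (Kt : ℕ) (hd3 : 3 ≤ (F.P Kt).d)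
    (Z Λ : Set (Site (F.P Kt) 0)) {k : ℕ} (hk0 : 0 < k) (hk : k ≤ (F.P Kt).m + (F.P Kt).K)
    (lo hi : Fin (F.P Kt).d → ℤ) (n : ℕ) (hn : ∀ κ, hi κ ≤ lo κ + n) (hlohi : lo ≤ hi)
    (hbox : pts k Λ = (castSite '' Set.Icc lo hi : Set (Site (F.P Kt) k)))
    (hZ : (boxPlaqs (lo - 1) (hi + 1) : Set (Plaq (F.P Kt) k)) ⊆ plaqsInside (pts k Z))
    (hN3 : ∀ κ, hi κ - lo κ + 3 < ((F.P Kt).sitesPerDir k : ℤ))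
    (ext : GaugeField (F.P Kt) k SU2 → GaugeField (F.P Kt) k SU2) (hext : ∀ W, ext W = extend (pts k Λ) (shellGauge W lo hi) W)
    (hZblk : IsBlockUnion k Z) (hM2 : 2 ≤ ν.M₁) (hdiv : side (F.P Kt).L ν.M₁ k ∣ (F.P Kt).sitesPerDir 0)
    {cE B₃ a₀ a₁ : ℝ} (hcE : 12 * ((F.P Kt).d : ℝ) * ((n : ℝ) + 2) ^ 2 ≤ cE)
    (h15T : ∀ (s : B14.Eq218Concrete.Seq (fun n : ℕ => Node00.unionsOfCubes (F.P Kt) (side (F.P Kt).L ν.M₁ n)) k),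
      Node00.Sect2.SeqSeparated ν.M₁ s → 0 < ν.M₁ →
      ∀ (ε₀ : ℝ) (δ : ℕ → ℝ), (∀ j, j ≤ k → 0 < δ j ∧ δ j ≤ a₁ ∧ B₃ * δ j ≤ ε₀) → (∀ j, j < k → δ j ≤ 2 * δ (j + 1)) →
      (∀ j, j < k → δ (j + 1) ≤ 2 * δ j) → ε₀ ≤ a₀ →
      ∀ W : MSField (F.P Kt) SU2,
        Node00.Sect2.DataSmall7PTop (Node00.avOfRecord F 2 Kt) s.Ω (Node00.suppDomOfRecord F ν Kt s.Ω) k δ W →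
        ∀ U₀ : GaugeField (F.P Kt) 0 SU2, IsMinimizer (Node00.avOfRecord F 2 Kt)
            {U | (∀ j, j ≤ k → PlaqSmallOn (Node00.Sect2.omegaPlaqsTop s.Ω (Node00.suppDomOfRecord F ν Kt s.Ω) j)
                (ε₀ * (F.P Kt).eta j ^ 2) U) ∧
              Node00.Sect2.CoDivClassOnTop s.Ω (Node00.suppDomOfRecord F ν Kt s.Ω) k ε₀ U}
            (genSet s.Ω k) W U₀ →
          (∀ j, j ≤ k → PlaqSmallOn (Node00.Sect2.omegaPlaqsTop s.Ω (Node00.suppDomOfRecord F ν Kt s.Ω) j)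
              (B₃ * δ j * (F.P Kt).eta j ^ 2) U₀) ∧
            ∀ j, j ≤ k → Node00.Sect2.CoDivSmallOn (Node00.Sect2.omegaBondsTop s.Ω (Node00.suppDomOfRecord F ν Kt s.Ω) j)
              (B₃ * δ j * (F.P Kt).eta j ^ 3) U₀) :
    ∀ (e eR : ℝ) (Vk : GaugeField (F.P Kt) k SU2), 0 < eR → (cE + 1) * eR ≤ a₁ → B₃ * ((cE + 1) * eR) ≤ e → e ≤ ν.εreg → ν.εreg ≤ a₀ →
      PlaqSmallOn (plaqsInside (pts k (Z ∩ Λᶜ))) eR Vk →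
      ∀ U₀ : GaugeField (F.P Kt) 0 SU2,
        IsMinimizer (Node00.avOfRecord F 2 Kt) (Node00.regMSCoPOfRecord F 2 ν Kt k (maxDomT ν.M₁ Z)) (Bj ν.M₁ Z k)
          (avgFamily (Node00.avOfRecord F 2 Kt) (qsstarGIter0 k (ext Vk))) U₀ →
        U₀ ∈ Node00.regMSCoPOfRecord F 2 {ν with εreg := B₃ * ((cE + 1) * eR)} Kt k (maxDomT ν.M₁ Z) ∧
          IsMinimizer (Node00.avOfRecord F 2 Kt) (Node00.regMSCoPOfRecord F 2 {ν with εreg := e} Kt k (maxDomT ν.M₁ Z)) (Bj ν.M₁ Z k)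
            (avgFamily (Node00.avOfRecord F 2 Kt) (qsstarGIter0 k (ext Vk))) U₀ := by
  intro e eR Vk heR ha₁ he heν ha₀ hVk U₀ hU₀
  have hd : 2 ≤ (F.P Kt).d := by omega
  have hcE0 : 0 ≤ cE := le_trans (by positivity) hcE
  have hV : PlaqSmallOn (plaqsInside (pts k Z)) ((cE + 1) * eR) (ext Vk) :=
    plaqSmallOn_extend_of_guard hd3 Z Λ lo hi n hn hlohi hbox hZ hN3 ext hext hcE heR Vk hVk
  exact mem_withEps_and_isMinimizer_withEps_of_plaqSmallOn_atLength ν Kt hd Z hk0 hk hZblk hM2 hdiv h15T ((cE + 1) * eR) e (ext Vk) (by positivity)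
    ha₁ he heν ha₀ hV U₀ hU₀

/-- ★★★ **AT-LENGTH edition of `…AtDatumScale.hMin_twoRadii_withEps_of_hMin` ([15] letter at the one length `k`). T4's `hMin` BODY IN TWO-RADII FORM, MINIMALITY READ AT THE DATUM SCALE** — the junction lemma of the lane ruling «(8)-FLOOR».  At one base field `V_k` of the strict guard
(`|V_k(∂p′) − 1| < eR` inside `(Z ∩ Λᶜ)^{(k)}`), the (J0′) letter of record (`Summits/…/BalabanUVNodesN12AtRecord13Prop1KnitThm1WindowDirectOfClassOnlyRowL1NearRadiusOfRecord` :164–:173,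
one instance, VERBATIM: a family `Ũ` entrywise holomorphic on the parameter ball `ball 0 R`, bounded by `𝓐` there, whose REAL points `(p, B′)` are minimisers over the class OF RECORD
`U_k({Ω_j(Z)}, εreg)` of the Wilson action with the perturbed (1.74) data `M˙(Q_k^{s*}(e^{iB′}·ext(e^{ip}·V_k)))`) IMPLIES the two-radii body: the SAME `Ũ`, clauses 1–2 on `ball 0 R`
unchanged (what the (K) row's Cauchy estimate reads), and clause 3 on the SMALLER real ball `‖p‖, ‖B′‖ < min R (eR∕8)` with minimality over the class at ANY tolerance
`e ∈ [2B₃(c_E+1)eR, εreg]` (what the chart half's `∀ᶠ` second-order condition reads) — by §2 the perturbed datum is `(c_E+1)(eR + 4‖p‖ + 4‖B′‖) < 2(c_E+1)eR`-regular there, so §1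
applies.  Numerics: `2(c_E+1)eR ≤ a₁`, `2B₃(c_E+1)eR ≤ e ≤ εreg ≤ a₀`. [cite: Balaban1985Variational, (2),(6),(7) p.278, Thm 1 (8) p.279; Balaban1989LargeFieldI, (1.74) p.192, p.193 L14–20, Prop. 1 (1.77)–(1.78) p.194; Balaban1989LargeFieldII, p.357, (1.7)–(1.9) p.358; Balaban1988Convergent, (2.12)–(2.13) pp.256–257] -/
theorem hMin_twoRadii_withEps_of_hMin_atLength (ν : Node00.Stage7Numerics) (Kt : ℕ) (hd3 : 3 ≤ (F.P Kt).d)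
    (Z Λ : Set (Site (F.P Kt) 0)) {k : ℕ} (hk0 : 0 < k) (hk : k ≤ (F.P Kt).m + (F.P Kt).K)
    (lo hi : Fin (F.P Kt).d → ℤ) (n : ℕ) (hn : ∀ κ, hi κ ≤ lo κ + n) (hlohi : lo ≤ hi)
    (hbox : pts k Λ = (castSite '' Set.Icc lo hi : Set (Site (F.P Kt) k)))
    (hZ : (boxPlaqs (lo - 1) (hi + 1) : Set (Plaq (F.P Kt) k)) ⊆ plaqsInside (pts k Z))
    (hN3 : ∀ κ, hi κ - lo κ + 3 < ((F.P Kt).sitesPerDir k : ℤ))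
    (ext : GaugeField (F.P Kt) k SU2 → GaugeField (F.P Kt) k SU2) (hext : ∀ W, ext W = extend (pts k Λ) (shellGauge W lo hi) W)
    (hZblk : IsBlockUnion k Z) (hM2 : 2 ≤ ν.M₁) (hdiv : side (F.P Kt).L ν.M₁ k ∣ (F.P Kt).sitesPerDir 0)
    {cE B₃ a₀ a₁ : ℝ} (hcE : 12 * ((F.P Kt).d : ℝ) * ((n : ℝ) + 2) ^ 2 ≤ cE)
    (h15T : ∀ (s : B14.Eq218Concrete.Seq (fun n : ℕ => Node00.unionsOfCubes (F.P Kt) (side (F.P Kt).L ν.M₁ n)) k),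
      Node00.Sect2.SeqSeparated ν.M₁ s → 0 < ν.M₁ →
      ∀ (ε₀ : ℝ) (δ : ℕ → ℝ), (∀ j, j ≤ k → 0 < δ j ∧ δ j ≤ a₁ ∧ B₃ * δ j ≤ ε₀) → (∀ j, j < k → δ j ≤ 2 * δ (j + 1)) →
      (∀ j, j < k → δ (j + 1) ≤ 2 * δ j) → ε₀ ≤ a₀ →
      ∀ W : MSField (F.P Kt) SU2,
        Node00.Sect2.DataSmall7PTop (Node00.avOfRecord F 2 Kt) s.Ω (Node00.suppDomOfRecord F ν Kt s.Ω) k δ W →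
        ∀ U₀ : GaugeField (F.P Kt) 0 SU2, IsMinimizer (Node00.avOfRecord F 2 Kt)
            {U | (∀ j, j ≤ k → PlaqSmallOn (Node00.Sect2.omegaPlaqsTop s.Ω (Node00.suppDomOfRecord F ν Kt s.Ω) j)
                (ε₀ * (F.P Kt).eta j ^ 2) U) ∧
              Node00.Sect2.CoDivClassOnTop s.Ω (Node00.suppDomOfRecord F ν Kt s.Ω) k ε₀ U}
            (genSet s.Ω k) W U₀ →
          (∀ j, j ≤ k → PlaqSmallOn (Node00.Sect2.omegaPlaqsTop s.Ω (Node00.suppDomOfRecord F ν Kt s.Ω) j)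
              (B₃ * δ j * (F.P Kt).eta j ^ 2) U₀) ∧
            ∀ j, j ≤ k → Node00.Sect2.CoDivSmallOn (Node00.Sect2.omegaBondsTop s.Ω (Node00.suppDomOfRecord F ν Kt s.Ω) j)
              (B₃ * δ j * (F.P Kt).eta j ^ 3) U₀)
    {e eR : ℝ} (heR : 0 < eR) (ha₁ : 2 * ((cE + 1) * eR) ≤ a₁) (he : B₃ * (2 * ((cE + 1) * eR)) ≤ e) (heν : e ≤ ν.εreg) (ha₀ : ν.εreg ≤ a₀)
    (Vk : GaugeField (F.P Kt) k SU2) (hVk : PlaqSmallOn (plaqsInside (pts k (Z ∩ Λᶜ))) eR Vk) {R 𝓐 : ℝ}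
    -- T4's `hMin` body at `(Z, Λ, k, ext, V_k)`: ONE radius, class OF RECORD
    (hMin : ∃ Ũ : VecField (F.P Kt) k (EuclideanSpace ℂ (Fin 3)) × VecField (F.P Kt) k (EuclideanSpace ℂ (Fin 3)) → PBond (F.P Kt) 0 → Matrix (Fin 2) (Fin 2) ℂ,
      (∀ b i j, DifferentiableOn ℂ (fun z => Ũ z b i j) (ball 0 R)) ∧
      (∀ z ∈ ball (0 : VecField (F.P Kt) k (EuclideanSpace ℂ (Fin 3)) × VecField (F.P Kt) k (EuclideanSpace ℂ (Fin 3))) R, ∀ b i j, ‖Ũ z b i j‖ ≤ 𝓐) ∧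
      ∀ p B' : VecField (F.P Kt) k E3, ‖p‖ < R → ‖B'‖ < R → ∃ U' : GaugeField (F.P Kt) 0 SU2,
        (∀ b, Ũ (cplxVec p, cplxVec B') b = ((U' b : SU2) : Matrix (Fin 2) (Fin 2) ℂ)) ∧
          IsMinimizer (Node00.avOfRecord F 2 Kt) (Node00.regMSCoPOfRecord F 2 ν Kt k (maxDomT ν.M₁ Z)) (Bj ν.M₁ Z k)
            (avgFamily (Node00.avOfRecord F 2 Kt) (qsstarGIter0 k (expMul su2Chart B' (ext (expMul su2Chart p Vk))))) U') :
    ∃ Ũ : VecField (F.P Kt) k (EuclideanSpace ℂ (Fin 3)) × VecField (F.P Kt) k (EuclideanSpace ℂ (Fin 3)) → PBond (F.P Kt) 0 → Matrix (Fin 2) (Fin 2) ℂ,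
      (∀ b i j, DifferentiableOn ℂ (fun z => Ũ z b i j) (ball 0 R)) ∧
      (∀ z ∈ ball (0 : VecField (F.P Kt) k (EuclideanSpace ℂ (Fin 3)) × VecField (F.P Kt) k (EuclideanSpace ℂ (Fin 3))) R, ∀ b i j, ‖Ũ z b i j‖ ≤ 𝓐) ∧
      ∀ p B' : VecField (F.P Kt) k E3, ‖p‖ < min R (eR / 8) → ‖B'‖ < min R (eR / 8) → ∃ U' : GaugeField (F.P Kt) 0 SU2,
        (∀ b, Ũ (cplxVec p, cplxVec B') b = ((U' b : SU2) : Matrix (Fin 2) (Fin 2) ℂ)) ∧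
          U' ∈ Node00.regMSCoPOfRecord F 2 {ν with εreg := B₃ * (2 * ((cE + 1) * eR))} Kt k (maxDomT ν.M₁ Z) ∧
          IsMinimizer (Node00.avOfRecord F 2 Kt) (Node00.regMSCoPOfRecord F 2 {ν with εreg := e} Kt k (maxDomT ν.M₁ Z)) (Bj ν.M₁ Z k)
            (avgFamily (Node00.avOfRecord F 2 Kt) (qsstarGIter0 k (expMul su2Chart B' (ext (expMul su2Chart p Vk))))) U' := by
  obtain ⟨Ũ, han, hbd, hreal⟩ := hMin
  have hd : 2 ≤ (F.P Kt).d := by omega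
  have hcE0 : 0 ≤ cE := le_trans (by positivity) hcE
  refine ⟨Ũ, han, hbd, fun p B' hp hB' => ?_⟩
  obtain ⟨U', hU', hmin⟩ := hreal p B' (lt_of_lt_of_le hp (min_le_left _ _)) (lt_of_lt_of_le hB' (min_le_left _ _))
  -- the perturbed datum's level-`k` field is `2(c_E+1)eR`-regular inside `Z^{(k)}`
  have hp8 : ‖p‖ < eR / 8 := lt_of_lt_of_le hp (min_le_right _ _)
  have hB8 : ‖B'‖ < eR / 8 := lt_of_lt_of_le hB' (min_le_right _ _)
  have hreg := plaqSmallOn_expMul_extend_expMul hd3 Z Λ lo hi n hn hlohi hbox hZ hN3 ext hext hcE heR Vk hVk p B'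
  have hreg2 : PlaqSmallOn (plaqsInside (pts k Z)) (2 * ((cE + 1) * eR)) (expMul su2Chart B' (ext (expMul su2Chart p Vk))) := by
    intro q hq
    refine (hreg q hq).trans_le ?_
    have h1 : eR + 4 * ‖p‖ + 4 * ‖B'‖ ≤ 2 * eR := by linarith
    nlinarith
  obtain ⟨hmem, hmin'⟩ := mem_withEps_and_isMinimizer_withEps_of_plaqSmallOn_atLength ν Kt hd Z hk0 hk hZblk hM2 hdiv h15T (2 * ((cE + 1) * eR)) e
    (expMul su2Chart B' (ext (expMul su2Chart p Vk))) (by positivity) ha₁ he heν ha₀ hreg2 U' hmin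
  exact ⟨U', hU', hmem, hmin'⟩

end AtDatumScale

/-! ## §4  The chart half's `∀ᶠ` row: the Federbush family's configurations minimise over the class AT THE DATUM SCALE, eventually -/

section Eventually

open Filter Topology
open B15Prop1SliceCoordinates (GaugeSlice ιA)
open B15Prop1SliceTaylorCalculus (norm_ιA_le)

variable {Kt : ℕ}

/-- ★★★ **AT-LENGTH edition of `…AtDatumScale.isMinimizer_withEps_of_norm_lt` (= T4′'s `hKb` with the [15] letter at the one length `k`). EVERY CLASS-OF-RECORD MINIMISER OF A SLICE-PERTURBED DATUM `e^{i·ιA Y}·ext V_k`, `‖Y‖ < eR∕8`, LIES IN THE CLASS AT `2B₃(c_E+1)eR` AND MINIMISES OVER THE CLASS AT EVERY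
`e ∈ [2B₃(c_E+1)eR, εreg]`** — the radius form of dag-n12-d's conversion letter (K-b) (T1′'s `hKb`, radius `r := eR∕8`): for a base field `V_k` of the strict guard at `eR`, a coordinate
`Y ∈ GaugeSlice(Λ^{(k)}, T)` with `‖Y‖ < eR∕8`, and ANY configuration `U` minimising the Wilson action over `U_k({Ω_j(Z)}, εreg)` with the data `M˙(Q_k^{s*}(e^{i·ιA Y}·ext V_k))`: the
perturbed datum's level-`k` field is `(c_E+1)eR + 4‖ιA Y‖ < 2(c_E+1)eR`-regular inside `Z^{(k)}` (§2, `‖ιA Y‖ ≤ ‖Y‖`), so §1 applies.  Only the (8)-letter `h15T` is used.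
[cite: Balaban1985Variational, (2),(6),(7) p.278, Thm 1 (8) p.279; Balaban1989LargeFieldI, (1.74) p.192, p.193 L14–20, Prop. 1 p.194; Balaban1989LargeFieldII, p.357, (1.7)–(1.9) p.358, (1.12) p.359; Balaban1988Convergent, (2.12)–(2.13) pp.256–257] -/
theorem isMinimizer_withEps_of_norm_lt_atLength (ν : Node00.Stage7Numerics) (Kt : ℕ) (hd3 : 3 ≤ (F.P Kt).d)
    (Z Λ : Set (Site (F.P Kt) 0)) {k : ℕ} (hk0 : 0 < k) (hk : k ≤ (F.P Kt).m + (F.P Kt).K)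
    (lo hi : Fin (F.P Kt).d → ℤ) (n : ℕ) (hn : ∀ κ, hi κ ≤ lo κ + n) (hlohi : lo ≤ hi)
    (hbox : pts k Λ = (castSite '' Set.Icc lo hi : Set (Site (F.P Kt) k)))
    (hZ : (boxPlaqs (lo - 1) (hi + 1) : Set (Plaq (F.P Kt) k)) ⊆ plaqsInside (pts k Z))
    (hN3 : ∀ κ, hi κ - lo κ + 3 < ((F.P Kt).sitesPerDir k : ℤ))
    (ext : GaugeField (F.P Kt) k SU2 → GaugeField (F.P Kt) k SU2) (hext : ∀ W, ext W = extend (pts k Λ) (shellGauge W lo hi) W)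
    (hZblk : IsBlockUnion k Z) (hM2 : 2 ≤ ν.M₁) (hdiv : side (F.P Kt).L ν.M₁ k ∣ (F.P Kt).sitesPerDir 0)
    {cE B₃ a₀ a₁ : ℝ} (hcE : 12 * ((F.P Kt).d : ℝ) * ((n : ℝ) + 2) ^ 2 ≤ cE)
    (h15T : ∀ (s : B14.Eq218Concrete.Seq (fun n : ℕ => Node00.unionsOfCubes (F.P Kt) (side (F.P Kt).L ν.M₁ n)) k),
      Node00.Sect2.SeqSeparated ν.M₁ s → 0 < ν.M₁ →
      ∀ (ε₀ : ℝ) (δ : ℕ → ℝ), (∀ j, j ≤ k → 0 < δ j ∧ δ j ≤ a₁ ∧ B₃ * δ j ≤ ε₀) → (∀ j, j < k → δ j ≤ 2 * δ (j + 1)) →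
      (∀ j, j < k → δ (j + 1) ≤ 2 * δ j) → ε₀ ≤ a₀ →
      ∀ W : MSField (F.P Kt) SU2,
        Node00.Sect2.DataSmall7PTop (Node00.avOfRecord F 2 Kt) s.Ω (Node00.suppDomOfRecord F ν Kt s.Ω) k δ W →
        ∀ U₀ : GaugeField (F.P Kt) 0 SU2, IsMinimizer (Node00.avOfRecord F 2 Kt)
            {U | (∀ j, j ≤ k → PlaqSmallOn (Node00.Sect2.omegaPlaqsTop s.Ω (Node00.suppDomOfRecord F ν Kt s.Ω) j)
                (ε₀ * (F.P Kt).eta j ^ 2) U) ∧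
              Node00.Sect2.CoDivClassOnTop s.Ω (Node00.suppDomOfRecord F ν Kt s.Ω) k ε₀ U}
            (genSet s.Ω k) W U₀ →
          (∀ j, j ≤ k → PlaqSmallOn (Node00.Sect2.omegaPlaqsTop s.Ω (Node00.suppDomOfRecord F ν Kt s.Ω) j)
              (B₃ * δ j * (F.P Kt).eta j ^ 2) U₀) ∧
            ∀ j, j ≤ k → Node00.Sect2.CoDivSmallOn (Node00.Sect2.omegaBondsTop s.Ω (Node00.suppDomOfRecord F ν Kt s.Ω) j)
              (B₃ * δ j * (F.P Kt).eta j ^ 3) U₀)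
    {e eR : ℝ} (heR : 0 < eR) (ha₁ : 2 * ((cE + 1) * eR) ≤ a₁) (he : B₃ * (2 * ((cE + 1) * eR)) ≤ e) (heν : e ≤ ν.εreg) (ha₀ : ν.εreg ≤ a₀)
    (Vk : GaugeField (F.P Kt) k SU2) (hVk : PlaqSmallOn (plaqsInside (pts k (Z ∩ Λᶜ))) eR Vk)
    (T : Finset (PBond (F.P Kt) k)) :
    ∀ (Y : GaugeSlice (pts k Λ) T E3), ‖Y‖ < eR / 8 → ∀ U : GaugeField (F.P Kt) 0 SU2,
      IsMinimizer (Node00.avOfRecord F 2 Kt) (Node00.regMSCoPOfRecord F 2 ν Kt k (maxDomT ν.M₁ Z)) (Bj ν.M₁ Z k)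
        (avgFamily (Node00.avOfRecord F 2 Kt) (qsstarGIter0 k (expMul su2Chart (ιA (pts k Λ) T Y) (ext Vk)))) U →
      U ∈ Node00.regMSCoPOfRecord F 2 {ν with εreg := B₃ * (2 * ((cE + 1) * eR))} Kt k (maxDomT ν.M₁ Z) ∧
        IsMinimizer (Node00.avOfRecord F 2 Kt) (Node00.regMSCoPOfRecord F 2 {ν with εreg := e} Kt k (maxDomT ν.M₁ Z)) (Bj ν.M₁ Z k)
          (avgFamily (Node00.avOfRecord F 2 Kt) (qsstarGIter0 k (expMul su2Chart (ιA (pts k Λ) T Y) (ext Vk)))) U := by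
  intro Y hY U hmin
  have hd : 2 ≤ (F.P Kt).d := by omega
  have hcE0 : 0 ≤ cE := le_trans (by positivity) hcE
  -- the base datum's extension is `(c_E+1)eR`-regular; the perturbation costs `4‖ιA Y‖ ≤ 4‖Y‖`
  have hext0 : PlaqSmallOn (plaqsInside (pts k Z)) ((cE + 1) * eR) (ext Vk) :=
    plaqSmallOn_extend_of_guard hd3 Z Λ lo hi n hn hlohi hbox hZ hN3 ext hext hcE heR Vk hVk
  have hι : ‖ιA (pts k Λ) T Y‖ ≤ ‖Y‖ := norm_ιA_le (pts k Λ) T Y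
  have h1 : PlaqSmallOn (plaqsInside (pts k Z)) ((cE + 1) * eR + 4 * ‖ιA (pts k Λ) T Y‖) (expMul su2Chart (ιA (pts k Λ) T Y) (ext Vk)) :=
    plaqSmallOn_expMul_of_plaqSmallOn hext0 _
  have h2 : PlaqSmallOn (plaqsInside (pts k Z)) (2 * ((cE + 1) * eR)) (expMul su2Chart (ιA (pts k Λ) T Y) (ext Vk)) := by
    intro q hq
    refine (h1 q hq).trans_le ?_
    nlinarith
  exact mem_withEps_and_isMinimizer_withEps_of_plaqSmallOn_atLength ν Kt hd Z hk0 hk hZblk hM2 hdiv h15T (2 * ((cE + 1) * eR)) e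
    (expMul su2Chart (ιA (pts k Λ) T Y) (ext Vk)) (by positivity) ha₁ he heν ha₀ h2 U hmin

/-- ★★★ **AT-LENGTH edition of `…AtDatumScale.eventually_isMinimizer_withEps_of_eventually` ([15] letter at the one length `k`). THE CHART HALF's `∀ᶠ` ROW AT THE DATUM SCALE** — dag-n12-d's callback (K-b), `∀ᶠ` form.  For a base field `V_k` of the strict guard at `eR` and ANY family of configurations
`Φ : GaugeSlice(Λ^{(k)}, T) → configurations` which, for `Y` near `0`, minimise the Wilson action over the class OF RECORD `U_k({Ω_j(Z)}, εreg)` with the perturbed (1.74) data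
`M˙(Q_k^{s*}(e^{i·ιA Y}·ext V_k))` (T4's `hhalf` premise :233–:235, the Federbush family `Y ↦ expChart U₀ (X_f Y)`): for `Y` near `0` the configuration `Φ Y` LIES IN the class at
`2B₃(c_E+1)eR` and MINIMISES over the class at every `e ∈ [2B₃(c_E+1)eR, εreg]` (the radius form on `‖Y‖ < eR∕8`).  Only the (8)-letter `h15T` is used (no existence ∕ uniqueness
letter). [cite: Balaban1985Variational, (2),(6),(7) p.278, Thm 1 (8) p.279; Balaban1989LargeFieldI, (1.74) p.192, p.193 L14–20, Prop. 1 p.194; Balaban1989LargeFieldII, p.357, (1.7)–(1.9) p.358, (1.12) p.359; Balaban1988Convergent, (2.12)–(2.13) pp.256–257] -/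
theorem eventually_isMinimizer_withEps_of_eventually_atLength (ν : Node00.Stage7Numerics) (Kt : ℕ) (hd3 : 3 ≤ (F.P Kt).d)
    (Z Λ : Set (Site (F.P Kt) 0)) {k : ℕ} (hk0 : 0 < k) (hk : k ≤ (F.P Kt).m + (F.P Kt).K)
    (lo hi : Fin (F.P Kt).d → ℤ) (n : ℕ) (hn : ∀ κ, hi κ ≤ lo κ + n) (hlohi : lo ≤ hi)
    (hbox : pts k Λ = (castSite '' Set.Icc lo hi : Set (Site (F.P Kt) k)))
    (hZ : (boxPlaqs (lo - 1) (hi + 1) : Set (Plaq (F.P Kt) k)) ⊆ plaqsInside (pts k Z))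
    (hN3 : ∀ κ, hi κ - lo κ + 3 < ((F.P Kt).sitesPerDir k : ℤ))
    (ext : GaugeField (F.P Kt) k SU2 → GaugeField (F.P Kt) k SU2) (hext : ∀ W, ext W = extend (pts k Λ) (shellGauge W lo hi) W)
    (hZblk : IsBlockUnion k Z) (hM2 : 2 ≤ ν.M₁) (hdiv : side (F.P Kt).L ν.M₁ k ∣ (F.P Kt).sitesPerDir 0)
    {cE B₃ a₀ a₁ : ℝ} (hcE : 12 * ((F.P Kt).d : ℝ) * ((n : ℝ) + 2) ^ 2 ≤ cE)
    (h15T : ∀ (s : B14.Eq218Concrete.Seq (fun n : ℕ => Node00.unionsOfCubes (F.P Kt) (side (F.P Kt).L ν.M₁ n)) k),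
      Node00.Sect2.SeqSeparated ν.M₁ s → 0 < ν.M₁ →
      ∀ (ε₀ : ℝ) (δ : ℕ → ℝ), (∀ j, j ≤ k → 0 < δ j ∧ δ j ≤ a₁ ∧ B₃ * δ j ≤ ε₀) → (∀ j, j < k → δ j ≤ 2 * δ (j + 1)) →
      (∀ j, j < k → δ (j + 1) ≤ 2 * δ j) → ε₀ ≤ a₀ →
      ∀ W : MSField (F.P Kt) SU2,
        Node00.Sect2.DataSmall7PTop (Node00.avOfRecord F 2 Kt) s.Ω (Node00.suppDomOfRecord F ν Kt s.Ω) k δ W →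
        ∀ U₀ : GaugeField (F.P Kt) 0 SU2, IsMinimizer (Node00.avOfRecord F 2 Kt)
            {U | (∀ j, j ≤ k → PlaqSmallOn (Node00.Sect2.omegaPlaqsTop s.Ω (Node00.suppDomOfRecord F ν Kt s.Ω) j)
                (ε₀ * (F.P Kt).eta j ^ 2) U) ∧
              Node00.Sect2.CoDivClassOnTop s.Ω (Node00.suppDomOfRecord F ν Kt s.Ω) k ε₀ U}
            (genSet s.Ω k) W U₀ →
          (∀ j, j ≤ k → PlaqSmallOn (Node00.Sect2.omegaPlaqsTop s.Ω (Node00.suppDomOfRecord F ν Kt s.Ω) j)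
              (B₃ * δ j * (F.P Kt).eta j ^ 2) U₀) ∧
            ∀ j, j ≤ k → Node00.Sect2.CoDivSmallOn (Node00.Sect2.omegaBondsTop s.Ω (Node00.suppDomOfRecord F ν Kt s.Ω) j)
              (B₃ * δ j * (F.P Kt).eta j ^ 3) U₀)
    {e eR : ℝ} (heR : 0 < eR) (ha₁ : 2 * ((cE + 1) * eR) ≤ a₁) (he : B₃ * (2 * ((cE + 1) * eR)) ≤ e) (heν : e ≤ ν.εreg) (ha₀ : ν.εreg ≤ a₀)
    (Vk : GaugeField (F.P Kt) k SU2) (hVk : PlaqSmallOn (plaqsInside (pts k (Z ∩ Λᶜ))) eR Vk)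
    (T : Finset (PBond (F.P Kt) k)) (Φ : GaugeSlice (pts k Λ) T E3 → GaugeField (F.P Kt) 0 SU2)
    -- T4's `hhalf` premise: the family's configurations are class-OF-RECORD minimisers of the perturbed data, for `Y` near `0`
    (hfam : ∀ᶠ Y in 𝓝 (0 : GaugeSlice (pts k Λ) T E3),
      IsMinimizer (Node00.avOfRecord F 2 Kt) (Node00.regMSCoPOfRecord F 2 ν Kt k (maxDomT ν.M₁ Z)) (Bj ν.M₁ Z k)
        (avgFamily (Node00.avOfRecord F 2 Kt) (qsstarGIter0 k (expMul su2Chart (ιA (pts k Λ) T Y) (ext Vk)))) (Φ Y)) :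
    ∀ᶠ Y in 𝓝 (0 : GaugeSlice (pts k Λ) T E3),
      Φ Y ∈ Node00.regMSCoPOfRecord F 2 {ν with εreg := B₃ * (2 * ((cE + 1) * eR))} Kt k (maxDomT ν.M₁ Z) ∧
        IsMinimizer (Node00.avOfRecord F 2 Kt) (Node00.regMSCoPOfRecord F 2 {ν with εreg := e} Kt k (maxDomT ν.M₁ Z)) (Bj ν.M₁ Z k)
          (avgFamily (Node00.avOfRecord F 2 Kt) (qsstarGIter0 k (expMul su2Chart (ιA (pts k Λ) T Y) (ext Vk)))) (Φ Y) := by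
  -- `Y` near `0` has `‖Y‖ < eR∕8`
  have hsmall : ∀ᶠ Y in 𝓝 (0 : GaugeSlice (pts k Λ) T E3), ‖Y‖ < eR / 8 :=
    Filter.mem_of_superset (Metric.ball_mem_nhds (0 : GaugeSlice (pts k Λ) T E3) (by positivity : 0 < eR / 8))
      fun Y hY => by simpa [Metric.mem_ball, dist_zero_right] using hY
  filter_upwards [hfam, hsmall] with Y hmin hY
  exact isMinimizer_withEps_of_norm_lt_atLength ν Kt hd3 Z Λ hk0 hk lo hi n hn hlohi hbox hZ hN3 ext hext hZblk hM2 hdiv hcE h15T heR ha₁ he heν ha₀ Vk hVk T Y hY (Φ Y) hmin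

end Eventually

end Literature.MathematicalPhysics.QuantumFieldTheory.Balaban1983to89.B15Prop1MinimiserClassAtDatumScaleAtLength

end
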